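import Literature.Probability.RandomPlanarGeometry.HexSAWSurfaceWallRenewalFloorSeventeen
import Literature.Probability.RandomPlanarGeometry.HexSAWSurfaceFifthOrderUpper
import HarnessLib

/-!
# The renewal mean to FOURTH order, exactly: `y⁴ (m(y) − 1 − 2y/β(y)⁶ − 3y/β(y)⁸) → 17`, i.e. `m(y) = 1 + 2/y² + 3/y³ + 11/y⁴ + o(y⁻⁴)`;
# the order-four analytic census: `N₆₂ = 1` (the hooked block is THE two-visit block of length twelve) and every irreducible
# positive wall bridge of length `n ≥ 14` has at most `n/2 − 5` surface visits (`N₇₃ = N₈₄ = N₉₅ = 0`)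

Topic `Literature/Probability/RandomPlanarGeometry` (lane «pcv-sawmu», a-p6 g18, car «FOURTH-EXACT-MEAN»; parents: the a-idea-1 pool cars
«FLOOR-SEVENTEEN» `HexSAWSurfaceWallRenewalFloorSeventeen.lean` (the hooked two-visit block `Twelve.qw ∈ ipwb 12`, `y²/β¹² ≤ f₆`, the floor
`12y/β¹⁰ + 5y²/β¹² ≤ m − 1 − 2y/β⁶ − 3y/β⁸`, `y⁶/β¹² → 1`, and `seventeen_le_of_tendsto_pow_four_mul`: IF the fourth-order limit `L` exists THEN
`17 ≤ L` — this file proves it exists and equals `17`), through it «TEN-THREE» (`pwbLaw_five_eq : f₅ = 3y/β¹⁰`, `N₅₁ = 3`, `y⁵/β¹⁰ → 1`) and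
«THIRD-EXACT» (`visits_le_two_of_mem_ipwb_twelve`, `hasSum_excess_tail_eight`, the order-three census whose method — Kesten's identity
`Σ_s f_s(y) = 1` evaluated at ONE large fugacity against an upper window for `β(y)²` — is repeated here one order up); and the same seat's
FIFTH-ORDER UPPER WINDOW `HexSAWSurfaceFifthOrderUpper.wallRate_sq_le_fifth` (`β(y)² ≤ y + 1/y + 1/y² + 2/y³ + 4/y⁴ + 6377300/y⁵`, `y ≥ 36`),
`HexSAWSurfaceWallRenewal` (`pwb`, `ipwb`, `IPWB`, `pwbLaw`, `pwbMean`, `hasSum_pwbLaw`, `pwbLaw_le_geom`, the entropy bound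
`four_mul_visits_le : 4·visits ≤ n + 2`), `HexSAWSurfaceWallRenewalExcessLimit.card_ipwb_le_three_pow`, `HexSAWSurfaceSecondOrderSharp`
(`wallRate_sq_le_sharp`, `tendsto_mul_wallRate_sq_sub : y (β² − y) → 1`), `HexSAWSurfaceSqrtAsymptotic` (`sqrt_le_wallRate`, `tendsto_wallRate_div_sqrt`).

Sources (primary; identifiers verbatim, no quotation marks).  N. Madras, G. Slade, *The Self-Avoiding Walk*, Birkhäuser 1993: Section 1.2,
(1.2.3) and Definition 1.2.4; Section 4.2, Definition 4.2.1, (4.2.2)–(4.2.5) and Theorem 4.2.2 (pp. 91–92), remark before (4.2.21) (p. 94).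
H. Kesten, J. Math. Phys. 4 (1963) 960, Section 4 (irreducible bridges, `Σ_n λ_n μ^{-n} = 1`).  W. Feller, *An Introduction to Probability
Theory and Its Applications* I (3rd ed. 1968), XIII.3 (renewal equation, mean recurrence time).  H. Duminil-Copin, A. Hammond, CMP 324 (2013),
Section 2.2 (renewal points, irreducible bridges).  I. G. Enting, I. Jensen, LNP 775 (2009), Section 7.4.2, Fig. 7.10 (brickwork form of the
honeycomb lattice).  E. J. Janse van Rensburg, *The Statistical Mechanics of Interacting Walks, Polygons, Animals and Vesicles*, OUP 2000,
Section 3.3.2, Lemma 3.20.  N. R. Beaton, M. Bousquet-Mélou, J. de Gier, H. Duminil-Copin, A. J. Guttmann, CMP 326 (2014) = arXiv:1109.0358v5,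
Section 3.1, Proposition 5 (p. 9: `μ(y) ≥ √y`) and p. 10 (first-order remark).  H. Duminil-Copin, S. Smirnov, Ann. Math. 175 (2012), Theorem 1.

## The device (why the third coefficient of `β²` decides the fourth order of `m`)

Write `u = 1/y` and let `N_{s,v}` be the number of irreducible positive wall bridges of length `2s` with `v` surface visits.  A class `(s, v)`
enters Kesten's identity `Σ_{s,v} N_{s,v} y^v/β^{2s} = 1` at order `u^{s−v}`.  The known blocks — atom `(1,1)`, dip `(3,1)`, flat excursion
`(4,1)`, the three tens `(5,1)` («TEN-THREE») and ONE hooked twelve `(6,2)` («FLOOR-SEVENTEEN») — already saturate the identity through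
order `u⁴` once `β² ≤ y + 1/y + 1/y² + 2/y³ + O(y⁻⁴)` is known (the EXACT third coefficient `2`, from the tree's fourth/fifth-order windows):
at `y = 10⁶` they leave room `< 9·10⁻²⁵ < y⁴·u^8 ≈ u⁴`, while a second two-visit twelve or any block in a class `(7,3)`, `(8,4)`, `(9,5)` would
add at least `y^{s−4}/β^{2s} ≥ 0.99999·10⁻²⁴`.  Hence `N₆₂ = 1`, `N₇₃ = N₈₄ = N₉₅ = 0`; the entropy bound covers `n ≥ 20`.  With that census
`m − 1 − 2f₃ − 3f₄ = 4f₅ + 5f₆ + Σ_{s≥7}(s−1)f_s = 12y/β¹⁰ + 5y²/β¹² + O(y⁻⁵) + O(y^{−9/2})`.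

## What is proved (namespace `…SAW.HexBW.Wall`; block lengths symbolic, `{m} (hm : m = 12)` etc.)

* §1 (private) the ROOM LEMMA at `y = 10⁶` one order up: the five known blocks and the fifth-order upper window leave room `< 9·10⁻²⁵`.
* §2 ★★★ THE ORDER-FOUR CENSUS.  `eq_qw_of_mem_ipwb_twelve_of_visits_eq_two` (a two-visit irreducible positive wall bridge of length twelve
  IS the hooked block), `twoVisit_ipwb_twelve_eq_singleton`, ★★★ `card_twoVisit_ipwb_twelve_eq_one` (**`N₆₂ = 1`**), `card_ipwb_twelve_eq`
  (`N₆ = N₆₁ + 1`); `visits_le_two_of_mem_ipwb_fourteen` (`N₇₃ = 0`), `visits_le_three_of_mem_ipwb_sixteen` (`N₈₄ = 0`),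
  `visits_le_four_of_mem_ipwb_eighteen` (`N₉₅ = 0`); ★★ `two_mul_visits_add_ten_le (hn : 14 ≤ n) : 2·visits + 10 ≤ n` — EVERY irreducible
  block of half-length `s ≥ 7` has at most `s − 5` visits (census for `n = 14, 16, 18`, entropy for `n ≥ 20`).
* §3 ★★ `IPWB_twelve_eq : Λ₁₂(y) = N₆₁·y + y²` (`N₆₁ = #` one-visit blocks of length twelve, symbolic), `pwbLaw_six_eq`,
  `IPWB_le_card_mul_pow_five`, `pwbLaw_le_card_div_pow_five : f_s ≤ #(ipwb 2s)/y⁵` (`s ≥ 7`), `head_six_mul_pwbLaw_le : 6f₇ + 7f₈ + 8f₉ ≤ 3429388773/y⁵`,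
  `five_mul_pwbLaw_six_le : 5f₆ ≤ 5y²/β¹² + 2657205/y⁵`.
* §4 `hasSum_excess_tail_ten`, ★ `excess_tail_ten_le (48 ≤ y) : m − 1 − (2f₃ + … + 8f₉) ≤ 20 μ²²/(y⁴√y)`,
  ★★ `pow_four_mul_pwbMean_sub_le (48 ≤ y) : y⁴(m − 1 − 2y/β⁶ − 3y/β⁸) ≤ 12·(y⁵/β¹⁰) + 5·(y⁶/β¹²) + 3432045978/y + 20 μ²²/√y` and the window.
* §5 ★★★ **`tendsto_pow_four_mul_pwbMean_sub : y⁴ (m(y) − 1 − 2y/β⁶ − 3y/β⁸) → 17`** (`17 = 4·N₅₁ + 5·N₆₂`; the limit posited by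
  «TEN-THREE»/«FLOOR-SEVENTEEN» exists), ★★★ `tendsto_pow_four_mul_pwbMean_sub_one_sub_sub : y⁴ (m(y) − 1 − 2/y² − 3/y³) → 11`
  (`2y/β⁶ = 2/y² − 6/y⁴ + o(y⁻⁴)` by `y(β² − y) → 1`), i.e. **`m(y) = 1 + 2/y² + 3/y³ + 11/y⁴ + o(y⁻⁴)`**, `isEquivalent_pwbMean_sub_three_terms`.

NOT claimed: the VALUE `N₆₁` (a brute-force census gives `6`; the one-visit blocks of length twelve are not classified here), `N₇₂` (census `3`),
hence not the fifth-order coefficient of `m`; nothing for `y ≤ μ⁴`; no statement about BBdGDCG's `μ(y)` beyond what the parents give.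
NEW IN WRITING (modest): the order-four census and the fourth-order renewal mean of the positive-wall-bridge renewal structure of the
adsorbing honeycomb walk are computed here; print has the renewal structure (M–S §4.2, Kesten §4) and first-order adsorption asymptotics only.
-/

namespace Literature.Probability.RandomPlanarGeometry.SAW.HexBW.Wall

open Finset Filter Function
open Literature.Probability.LatticeModels
open _root_.Topology Asymptotics

variable {y : ℝ} {n : ℕ} {ω : ℕ → Site 2}

/-! ### §0  Private helpers: `μ`, the block law as `Λ_{2s}/(β²)^s`, Kesten partial sums on `{1, 3, 4, 5, 6, s}` -/

/-- `μ² = 2 + √2`. [cite: DuminilCopinSmirnov2012, Theorem 1] -/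
private theorem mu_sq_fx : hexConnectiveConstant ^ 2 = 2 + Real.sqrt 2 := by
  rw [hexConnectiveConstant_eq_inv, inv_pow]; exact inv_eq_of_mul_eq_one_right hexCriticalFugacity_sq

/-- `4 ≤ μ⁴`. [cite: DuminilCopinSmirnov2012, Theorem 1] -/
private theorem four_le_mu_four_fx : 4 ≤ hexConnectiveConstant ^ 4 := by
  have h2 : 0 ≤ Real.sqrt 2 := Real.sqrt_nonneg 2
  calc (4 : ℝ) ≤ (2 + Real.sqrt 2) ^ 2 := by nlinarith
    _ = hexConnectiveConstant ^ 4 := by rw [← mu_sq_fx]; ring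

/-- `μ⁴ < 12`. [cite: DuminilCopinSmirnov2012, Theorem 1] -/
private theorem mu_four_lt_twelve_fx : hexConnectiveConstant ^ 4 < 12 := by
  have hup : Real.sqrt 2 ≤ 1.41422 := by
    rw [show (1.41422 : ℝ) = Real.sqrt (1.41422 ^ 2) by rw [Real.sqrt_sq (by norm_num)]]
    exact Real.sqrt_le_sqrt (by norm_num)
  have h2 : 0 ≤ Real.sqrt 2 := Real.sqrt_nonneg 2
  calc hexConnectiveConstant ^ 4 = (hexConnectiveConstant ^ 2) ^ 2 := by ring
    _ = (2 + Real.sqrt 2) ^ 2 := by rw [mu_sq_fx]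
    _ ≤ (2 + 1.41422) ^ 2 := by gcongr
    _ < 12 := by norm_num

/-- `μ⁴ < 10⁶`. [cite: DuminilCopinSmirnov2012, Theorem 1] -/
private theorem mu_four_lt_Y_fx : hexConnectiveConstant ^ 4 < 1000000 := mu_four_lt_twelve_fx.trans (by norm_num)

/-- `y ≤ β(y)²` (`β ≥ √y`). [cite: BeatonBousquetMelouDeGierDuminilCopinGuttmann2014, Section 3.1, Proposition 5 (arXiv v5 p. 9)] -/
private theorem le_sq_wallRate_fx (hy : 0 < y) : y ≤ wallRate y ^ 2 := by
  have h := pow_le_pow_left₀ (Real.sqrt_nonneg y) (sqrt_le_wallRate hy) 2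
  rwa [Real.sq_sqrt hy.le] at h

/-- `y^k ≤ β(y)^{2k}`. [cite: BeatonBousquetMelouDeGierDuminilCopinGuttmann2014, Section 3.1, Proposition 5 (arXiv v5 p. 9)] -/
private theorem pow_le_wallRate_pow_fx (hy : 0 < y) (k : ℕ) : y ^ k ≤ wallRate y ^ (2 * k) := by
  rw [pow_mul]; exact pow_le_pow_left₀ hy.le (le_sq_wallRate_fx hy) k

/-- `f_s(y) = Λ_{2s}(y)/(β(y)²)^s`. [cite: MadrasSlade1993, Section 4.2, (4.2.2) (p. 91)] -/
private theorem pwbLaw_eq_fx (y : ℝ) (s : ℕ) : pwbLaw y s = IPWB (2 * s) y / (wallRate y ^ 2) ^ s := by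
  rw [pwbLaw, pow_mul]

/-- A single irreducible block bounds `f_s` from below. [cite: MadrasSlade1993, Section 4.2, (4.2.2) (p. 91)] -/
private theorem single_div_le_pwbLaw_fx (hy : 0 ≤ y) {s n : ℕ} (hn : 2 * s = n) (hω : ω ∈ ipwb n) :
    y ^ visits n ω / (wallRate y ^ 2) ^ s ≤ pwbLaw y s := by
  subst hn
  rw [pwbLaw_eq_fx]
  exact div_le_div_of_nonneg_right (Finset.single_le_sum (fun _ _ => pow_nonneg hy _) hω) (pow_nonneg (sq_nonneg _) _)

/-- Two DISTINCT irreducible blocks bound `f_s` from below by the sum of their monomials. [cite: MadrasSlade1993, Section 4.2, (4.2.2) (p. 91)] -/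
private theorem pair_div_le_pwbLaw_fx (hy : 0 ≤ y) {s n : ℕ} (hn : 2 * s = n) {ω₁ ω₂ : ℕ → Site 2} (h₁ : ω₁ ∈ ipwb n)
    (h₂ : ω₂ ∈ ipwb n) (hne : ω₁ ≠ ω₂) :
    (y ^ visits n ω₁ + y ^ visits n ω₂) / (wallRate y ^ 2) ^ s ≤ pwbLaw y s := by
  classical
  subst hn
  rw [pwbLaw_eq_fx]
  refine div_le_div_of_nonneg_right ?_ (pow_nonneg (sq_nonneg _) _)
  have hsub : ({ω₁, ω₂} : Finset (ℕ → Site 2)) ⊆ ipwb (2 * s) := by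
    rw [Finset.insert_subset_iff, Finset.singleton_subset_iff]; exact ⟨h₁, h₂⟩
  have h := Finset.sum_le_sum_of_subset_of_nonneg hsub (f := fun ω => y ^ visits (2 * s) ω) fun _ _ _ => pow_nonneg hy _
  rwa [Finset.sum_pair hne] at h

/-- Kesten partial sums: `Σ_{s ∈ S} f_s(y) ≤ 1` for `y > μ⁴`. [cite: MadrasSlade1993, Section 4.2, (4.2.4) and Theorem 4.2.2 (pp. 91–92)] [cite: Kesten1963SAW, Section 4] -/
private theorem sum_pwbLaw_le_one_fx (hy : hexConnectiveConstant ^ 4 < y) (S : Finset ℕ) : ∑ s ∈ S, pwbLaw y s ≤ 1 := by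
  have hy0 : 0 ≤ y := by have := four_le_mu_four_fx; linarith
  exact sum_le_hasSum S (fun s _ => pwbLaw_nonneg hy0 s) (hasSum_pwbLaw hy)

/-- Kesten partial sum on `{1, 3, 4, 5, 6}`. [cite: MadrasSlade1993, Section 4.2, (4.2.4) (p. 91)] [cite: Kesten1963SAW, Section 4] -/
private theorem kesten_five_fx (hy : hexConnectiveConstant ^ 4 < y) :
    pwbLaw y 1 + (pwbLaw y 3 + (pwbLaw y 4 + (pwbLaw y 5 + pwbLaw y 6))) ≤ 1 := by
  have h := sum_pwbLaw_le_one_fx hy {1, 3, 4, 5, 6}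
  have h1 : (1 : ℕ) ∉ ({3, 4, 5, 6} : Finset ℕ) := by simp only [Finset.mem_insert, Finset.mem_singleton]; omega
  have h3 : (3 : ℕ) ∉ ({4, 5, 6} : Finset ℕ) := by simp only [Finset.mem_insert, Finset.mem_singleton]; omega
  have h4 : (4 : ℕ) ∉ ({5, 6} : Finset ℕ) := by simp only [Finset.mem_insert, Finset.mem_singleton]; omega
  have h5 : (5 : ℕ) ∉ ({6} : Finset ℕ) := by simp only [Finset.mem_singleton]; omega
  rwa [Finset.sum_insert h1, Finset.sum_insert h3, Finset.sum_insert h4, Finset.sum_insert h5, Finset.sum_singleton] at h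

/-- Kesten partial sum on `{1, 3, 4, 5, 6, s}`. [cite: MadrasSlade1993, Section 4.2, (4.2.4) (p. 91)] [cite: Kesten1963SAW, Section 4] -/
private theorem kesten_six_fx (hy : hexConnectiveConstant ^ 4 < y) {s : ℕ} (hs1 : s ≠ 1) (hs3 : s ≠ 3) (hs4 : s ≠ 4) (hs5 : s ≠ 5)
    (hs6 : s ≠ 6) : pwbLaw y 1 + (pwbLaw y 3 + (pwbLaw y 4 + (pwbLaw y 5 + (pwbLaw y 6 + pwbLaw y s)))) ≤ 1 := by
  have h := sum_pwbLaw_le_one_fx hy {1, 3, 4, 5, 6, s}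
  have h1 : (1 : ℕ) ∉ ({3, 4, 5, 6, s} : Finset ℕ) := by simp only [Finset.mem_insert, Finset.mem_singleton]; omega
  have h3 : (3 : ℕ) ∉ ({4, 5, 6, s} : Finset ℕ) := by simp only [Finset.mem_insert, Finset.mem_singleton]; omega
  have h4 : (4 : ℕ) ∉ ({5, 6, s} : Finset ℕ) := by simp only [Finset.mem_insert, Finset.mem_singleton]; omega
  have h5 : (5 : ℕ) ∉ ({6, s} : Finset ℕ) := by simp only [Finset.mem_insert, Finset.mem_singleton]; omega
  have h6 : (6 : ℕ) ∉ ({s} : Finset ℕ) := by simp only [Finset.mem_singleton]; omega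
  rwa [Finset.sum_insert h1, Finset.sum_insert h3, Finset.sum_insert h4, Finset.sum_insert h5, Finset.sum_insert h6,
    Finset.sum_singleton] at h

/-- Every irreducible positive wall bridge visits the surface at least once (its endpoint). [cite: MadrasSlade1993, Section 4.2, Definition 4.2.1 (p. 91)] -/
private theorem one_le_visits_fx (hω : ω ∈ ipwb n) : 1 ≤ visits n ω := by
  classical
  obtain ⟨hp, hn1, -⟩ := mem_ipwb.1 hω
  obtain ⟨hw, -⟩ := mem_pwb.1 hp
  obtain ⟨ha, -⟩ := mem_wbr.1 hw
  obtain ⟨-, hn2, hYn⟩ := mem_archs.1 ha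
  obtain ⟨k, rfl⟩ : ∃ k, n = k + 1 := ⟨n - 1, by omega⟩
  rw [visits_succ, if_pos ⟨hn2, hYn⟩]
  omega

/-- The length of an irreducible positive wall bridge is even (it is an arch). [cite: MadrasSlade1993, Section 1.2, Definition 1.2.4] -/
private theorem even_len_fx (hω : ω ∈ ipwb n) : n % 2 = 0 := by
  obtain ⟨hp, -, -⟩ := mem_ipwb.1 hω
  obtain ⟨hw, -⟩ := mem_pwb.1 hp
  obtain ⟨ha, -⟩ := mem_wbr.1 hw
  exact (mem_archs.1 ha).2.1

/-- `f₁(y) ≥ y/β²` (the atom `(0,0) → (1,0) → (2,0)`). [cite: MadrasSlade1993, Section 4.2, (4.2.2) (p. 91)] -/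
private theorem div_sq_wallRate_le_pwbLaw_one_fx (hy : 0 ≤ y) : y / wallRate y ^ 2 ≤ pwbLaw y 1 := by
  obtain ⟨m, hm⟩ : ∃ m : ℕ, m = 2 * 1 := ⟨_, rfl⟩
  have h := straightWalk_mem_pwb 1
  rw [← hm] at h
  have hmem : Zd.straightWalk 2 m ∈ ipwb m := by
    rw [mem_ipwb]
    refine ⟨h.1, by omega, fun k hk1 hk2 hr => ?_⟩
    have hk : k % 2 = 0 := hr.2.1
    omega
  have h1 := single_div_le_pwbLaw_fx (s := 1) (n := m) hy (by omega) hmem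
  rw [h.2, pow_one, pow_one] at h1
  exact h1

/-! ### §1  The room left by the FIVE known blocks at `y = 10⁶` is below `9·10⁻²⁵` (fifth-order upper window) -/

/-- **Room lemma (order four).**  At `y = 10⁶`: if `y/β² + (y/β⁶ + (y/β⁸ + (3y/β¹⁰ + (y²/β¹² + x)))) ≤ 1` then `x < 9·10⁻²⁵` — from
`y ≤ β²` and the fifth-order upper window `β² ≤ y + 1/y + 1/y² + 2/y³ + 4/y⁴ + 6377300/y⁵`: with `B = β²` and `d = B − y ∈ [0, 1.0000010000020001·10⁻⁶]`,
`B⁶ − yB⁵ − yB³ − yB² − 3yB − y²` is a polynomial in `d` with positive Taylor coefficients at `y`, so it is at most its value at the right end,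
`≈ 1.05·10⁸ < 9·10⁻²⁵ · y⁶ = 9·10¹¹`.  (Exactly: the known blocks leave `9/y⁵ + O(y⁻⁶)`.)
[cite: MadrasSlade1993, Section 4.2, (4.2.4) (p. 91)] [cite: BeatonBousquetMelouDeGierDuminilCopinGuttmann2014, Section 3.1, Proposition 5] -/
private theorem no_room4_fx {x : ℝ} (hx : (9 / 10 ^ 25 : ℝ) ≤ x)
    (h : 1000000 / wallRate 1000000 ^ 2 + (1000000 / wallRate 1000000 ^ 6 + (1000000 / wallRate 1000000 ^ 8 +
      (3 * 1000000 / wallRate 1000000 ^ 10 + (1000000 ^ 2 / wallRate 1000000 ^ 12 + x)))) ≤ 1) :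
    False := by
  have e6 : wallRate 1000000 ^ 6 = (wallRate 1000000 ^ 2) ^ 3 := by rw [← pow_mul]
  have e8 : wallRate 1000000 ^ 8 = (wallRate 1000000 ^ 2) ^ 4 := by rw [← pow_mul]
  have e10 : wallRate 1000000 ^ 10 = (wallRate 1000000 ^ 2) ^ 5 := by rw [← pow_mul]
  have e12 : wallRate 1000000 ^ 12 = (wallRate 1000000 ^ 2) ^ 6 := by rw [← pow_mul]
  rw [e6, e8, e10, e12] at h
  set B := wallRate 1000000 ^ 2 with hB
  have hlo : (1000000 : ℝ) ≤ B := le_sq_wallRate_fx (by norm_num)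
  have hhi : B ≤ 1000000 + 1 / 1000000 + 1 / 1000000 ^ 2 + 2 / 1000000 ^ 3 + 4 / 1000000 ^ 4 + 6377300 / 1000000 ^ 5 :=
    wallRate_sq_le_fifth (by norm_num)
  have hB0 : 0 < B := by linarith
  have hx0 : 0 ≤ x := le_trans (by norm_num) hx
  have key : 1000000 * B ^ 5 + 1000000 * B ^ 3 + 1000000 * B ^ 2 + 3 * 1000000 * B + 1000000 ^ 2 + x * B ^ 6 ≤ B ^ 6 := by
    have e : 1000000 / B + (1000000 / B ^ 3 + (1000000 / B ^ 4 + (3 * 1000000 / B ^ 5 + (1000000 ^ 2 / B ^ 6 + x)))) =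
        (1000000 * B ^ 5 + 1000000 * B ^ 3 + 1000000 * B ^ 2 + 3 * 1000000 * B + 1000000 ^ 2 + x * B ^ 6) / B ^ 6 := by
      field_simp
      ring
    rw [e, div_le_one (pow_pos hB0 6)] at h
    exact h
  -- Taylor expansion at `y = 10⁶` in `d = B − 10⁶ ∈ [0, δ]`
  set d := B - 1000000 with hd
  have hd0 : 0 ≤ d := by rw [hd]; linarith
  have hdδ : d ≤ 10000010000020001 / 10 ^ 22 := by
    have hnum : (1000000 : ℝ) + 1 / 1000000 + 1 / 1000000 ^ 2 + 2 / 1000000 ^ 3 + 4 / 1000000 ^ 4 + 6377300 / 1000000 ^ 5 ≤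
        1000000 + 10000010000020001 / 10 ^ 22 := by norm_num
    rw [hd]; linarith
  have hBd : B = 1000000 + d := by rw [hd]; ring
  have eP : B ^ 6 - (1000000 * B ^ 5 + 1000000 * B ^ 3 + 1000000 * B ^ 2 + 3 * 1000000 * B + 1000000 ^ 2) =
      -(1000000 ^ 4 + 1000000 ^ 3 + 4 * 1000000 ^ 2 : ℝ)
        + (1000000 ^ 5 - 3 * 1000000 ^ 3 - 2 * 1000000 ^ 2 - 3 * 1000000) * d
        + (5 * 1000000 ^ 4 - 3 * 1000000 ^ 2 - 1000000) * d ^ 2 + (10 * 1000000 ^ 3 - 1000000) * d ^ 3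
        + 10 * 1000000 ^ 2 * d ^ 4 + 5 * 1000000 * d ^ 5 + d ^ 6 := by
    rw [hBd]; ring
  have h2 : d ^ 2 ≤ (10000010000020001 / 10 ^ 22) ^ 2 := pow_le_pow_left₀ hd0 hdδ 2
  have h3 : d ^ 3 ≤ (10000010000020001 / 10 ^ 22) ^ 3 := pow_le_pow_left₀ hd0 hdδ 3
  have h4 : d ^ 4 ≤ (10000010000020001 / 10 ^ 22) ^ 4 := pow_le_pow_left₀ hd0 hdδ 4
  have h5 : d ^ 5 ≤ (10000010000020001 / 10 ^ 22) ^ 5 := pow_le_pow_left₀ hd0 hdδ 5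
  have h6 : d ^ 6 ≤ (10000010000020001 / 10 ^ 22) ^ 6 := pow_le_pow_left₀ hd0 hdδ 6
  have hc1 : (1000000 ^ 5 - 3 * 1000000 ^ 3 - 2 * 1000000 ^ 2 - 3 * 1000000 : ℝ) * d ≤
      (1000000 ^ 5 - 3 * 1000000 ^ 3 - 2 * 1000000 ^ 2 - 3 * 1000000 : ℝ) * (10000010000020001 / 10 ^ 22) :=
    mul_le_mul_of_nonneg_left hdδ (by norm_num)
  have hc2 : (5 * 1000000 ^ 4 - 3 * 1000000 ^ 2 - 1000000 : ℝ) * d ^ 2 ≤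
      (5 * 1000000 ^ 4 - 3 * 1000000 ^ 2 - 1000000 : ℝ) * (10000010000020001 / 10 ^ 22) ^ 2 :=
    mul_le_mul_of_nonneg_left h2 (by norm_num)
  have hc3 : (10 * 1000000 ^ 3 - 1000000 : ℝ) * d ^ 3 ≤ (10 * 1000000 ^ 3 - 1000000 : ℝ) * (10000010000020001 / 10 ^ 22) ^ 3 :=
    mul_le_mul_of_nonneg_left h3 (by norm_num)
  have hc4 : (10 * 1000000 ^ 2 : ℝ) * d ^ 4 ≤ (10 * 1000000 ^ 2 : ℝ) * (10000010000020001 / 10 ^ 22) ^ 4 :=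
    mul_le_mul_of_nonneg_left h4 (by norm_num)
  have hc5 : (5 * 1000000 : ℝ) * d ^ 5 ≤ (5 * 1000000 : ℝ) * (10000010000020001 / 10 ^ 22) ^ 5 :=
    mul_le_mul_of_nonneg_left h5 (by norm_num)
  have hB6 : (1000000 : ℝ) ^ 6 ≤ B ^ 6 := pow_le_pow_left₀ (by norm_num) hlo 6
  have hx6 : (9 / 10 ^ 25 : ℝ) * 1000000 ^ 6 ≤ x * B ^ 6 := mul_le_mul hx hB6 (by norm_num) hx0
  have hnum : -(1000000 ^ 4 + 1000000 ^ 3 + 4 * 1000000 ^ 2 : ℝ)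
        + (1000000 ^ 5 - 3 * 1000000 ^ 3 - 2 * 1000000 ^ 2 - 3 * 1000000 : ℝ) * (10000010000020001 / 10 ^ 22)
        + (5 * 1000000 ^ 4 - 3 * 1000000 ^ 2 - 1000000 : ℝ) * (10000010000020001 / 10 ^ 22) ^ 2
        + (10 * 1000000 ^ 3 - 1000000 : ℝ) * (10000010000020001 / 10 ^ 22) ^ 3
        + (10 * 1000000 ^ 2 : ℝ) * (10000010000020001 / 10 ^ 22) ^ 4
        + (5 * 1000000 : ℝ) * (10000010000020001 / 10 ^ 22) ^ 5 + (10000010000020001 / 10 ^ 22) ^ 6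
        < (9 / 10 ^ 25 : ℝ) * 1000000 ^ 6 := by
    norm_num
  linarith

/-- A class term `y^a/β^{2b}` at `y = 10⁶` is at least `10^{6a}/1000001^b`. [cite: BeatonBousquetMelouDeGierDuminilCopinGuttmann2014, Section 3.1, Proposition 5] -/
private theorem class_term_ge_fx (a b : ℕ) :
    (1000000 : ℝ) ^ a / 1000001 ^ b ≤ 1000000 ^ a / (wallRate 1000000 ^ 2) ^ b := by
  have hlo : (1000000 : ℝ) ≤ wallRate 1000000 ^ 2 := le_sq_wallRate_fx (by norm_num)
  have hhi : wallRate 1000000 ^ 2 ≤ 1000000 + 1 / 1000000 + 8748 / 1000000 ^ 2 := wallRate_sq_le_sharp (by norm_num)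
  have hBhi : wallRate 1000000 ^ 2 ≤ 1000001 := by
    have : (1 : ℝ) / 1000000 + 8748 / 1000000 ^ 2 ≤ 1 := by norm_num
    linarith
  exact div_le_div_of_nonneg_left (by positivity) (pow_pos (by linarith) _) (pow_le_pow_left₀ (by linarith) hBhi b)

/-- The visit monomial is monotone in the number of visits at `y = 10⁶`. [cite: BeatonBousquetMelouDeGierDuminilCopinGuttmann2014, Section 3.1] -/
private theorem pow_visits_ge_fx {a v : ℕ} (hv : a ≤ v) (b : ℕ) :
    (1000000 : ℝ) ^ a / (wallRate 1000000 ^ 2) ^ b ≤ 1000000 ^ v / (wallRate 1000000 ^ 2) ^ b :=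
  div_le_div_of_nonneg_right (pow_le_pow_right₀ (by norm_num) hv) (pow_nonneg (sq_nonneg _) _)

/-- The five known blocks at `y = 10⁶`: `y/β² ≤ f₁`, `f₃ = y/β⁶`, `f₄ = y/β⁸`, `f₅ = 3y/β¹⁰`, `y²/β¹² ≤ f₆`.
[cite: MadrasSlade1993, Section 4.2, (4.2.2) (p. 91)] [cite: EntingJensen2009, Section 7.4.2, Fig. 7.10] -/
private theorem known_blocks4_fx :
    1000000 / wallRate 1000000 ^ 2 ≤ pwbLaw 1000000 1 ∧ pwbLaw 1000000 3 = 1000000 / wallRate 1000000 ^ 6 ∧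
      pwbLaw 1000000 4 = 1000000 / wallRate 1000000 ^ 8 ∧ pwbLaw 1000000 5 = 3 * 1000000 / wallRate 1000000 ^ 10 ∧
      1000000 ^ 2 / wallRate 1000000 ^ 12 ≤ pwbLaw 1000000 6 :=
  ⟨div_sq_wallRate_le_pwbLaw_one_fx (by norm_num), pwbLaw_three _, pwbLaw_four_eq _, pwbLaw_five_eq _,
    sq_div_le_pwbLaw_six (by norm_num)⟩

/-! ### §2  The order-four analytic census: `N₆₂ = 1`, `N₇₃ = N₈₄ = N₉₅ = 0`; every irreducible block of half-length `s ≥ 7` has at most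
`s − 5` visits -/

/-- ★★★ **A two-visit irreducible positive wall bridge of length twelve IS the hooked block** `(0,0)(1,0)(2,0)(3,0)(3,−1)(2,−1)(2,−2)(3,−2)
(4,−2)(4,−1)(5,−1)(5,0)(6,0)` (door D1 «TWELVE-ONE» of the lane, settled without a classification: a SECOND block in the class `(6,2)` would
add `≥ y²/β¹² ≈ 10⁻²⁴ > 9·10⁻²⁵` to Kesten's identity at `y = 10⁶`, where the five known blocks leave no such room).
[cite: MadrasSlade1993, Section 4.2, (4.2.4) and Theorem 4.2.2 (pp. 91–92)] [cite: Kesten1963SAW, Section 4] [cite: EntingJensen2009, Section 7.4.2, Fig. 7.10] -/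
theorem eq_qw_of_mem_ipwb_twelve_of_visits_eq_two {m : ℕ} (hm : m = 12) (hω : ω ∈ ipwb m) (hv : visits m ω = 2) :
    ω = Twelve.qw := by
  by_contra hne
  have hK := kesten_five_fx mu_four_lt_Y_fx
  obtain ⟨h1, h3, h4, h5, -⟩ := known_blocks4_fx
  have hq := qw_mem_ipwb hm
  have hvq : visits m Twelve.qw = 2 := by rw [hm]; exact Twelve.visits_qw
  have hs := pair_div_le_pwbLaw_fx (y := 1000000) (s := 6) (n := m) (by norm_num) (by omega) hω hq hne
  rw [hv, hvq] at hs
  have e12 : (wallRate 1000000 ^ 2) ^ 6 = wallRate 1000000 ^ 12 := by rw [← pow_mul]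
  rw [e12, add_div] at hs
  have hx : (9 / 10 ^ 25 : ℝ) ≤ 1000000 ^ 2 / wallRate 1000000 ^ 12 :=
    calc (9 / 10 ^ 25 : ℝ) ≤ 1000000 ^ 2 / 1000001 ^ 6 := by norm_num
      _ ≤ 1000000 ^ 2 / (wallRate 1000000 ^ 2) ^ 6 := class_term_ge_fx 2 6
      _ = _ := by rw [e12]
  exact no_room4_fx hx (by linarith)

open Classical in
/-- ★★ The two-visit irreducible positive wall bridges of length twelve form the singleton `{Twelve.qw}` (symbolic length).
[cite: MadrasSlade1993, Section 4.2, Definition 4.2.1, (4.2.2)] [cite: DuminilCopinHammond2013, Section 2.2] -/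
theorem twoVisit_ipwb_twelve_eq_singleton {m : ℕ} (hm : m = 12) :
    ((ipwb m).filter fun ω => visits m ω = 2) = {Twelve.qw} := by
  ext ω
  rw [Finset.mem_filter, Finset.mem_singleton]
  constructor
  · rintro ⟨hω, hv⟩
    exact eq_qw_of_mem_ipwb_twelve_of_visits_eq_two hm hω hv
  · rintro rfl
    exact ⟨qw_mem_ipwb hm, by rw [hm]; exact Twelve.visits_qw⟩

open Classical in
/-- ★★★ **`N₆₂ = 1`**: EXACTLY ONE irreducible positive wall bridge of length twelve has two surface visits (symbolic length).
[cite: MadrasSlade1993, Section 4.2, Definition 4.2.1, (4.2.2) and Theorem 4.2.2 (pp. 91–92)] [cite: Kesten1963SAW, Section 4] -/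
theorem card_twoVisit_ipwb_twelve_eq_one {m : ℕ} (hm : m = 12) : #((ipwb m).filter fun ω => visits m ω = 2) = 1 := by
  rw [twoVisit_ipwb_twelve_eq_singleton hm, Finset.card_singleton]

open Classical in
/-- ★ **`N₆ = N₆₁ + 1`**: the irreducible positive wall bridges of length twelve are the one-visit ones and the hooked block (every block of
length twelve has one or two visits — «THIRD-EXACT»). [cite: MadrasSlade1993, Section 4.2, Definition 4.2.1, (4.2.2)] [cite: Kesten1963SAW, Section 4] -/
theorem card_ipwb_twelve_eq {m : ℕ} (hm : m = 12) : #(ipwb m) = #((ipwb m).filter fun ω => visits m ω = 1) + 1 := by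
  have hneg : ((ipwb m).filter fun ω => ¬ visits m ω = 1) = (ipwb m).filter fun ω => visits m ω = 2 := by
    refine Finset.filter_congr fun ω hω => ?_
    have h1 := one_le_visits_fx hω
    have h2 := visits_le_two_of_mem_ipwb_twelve hm hω
    omega
  rw [← Finset.card_filter_add_card_filter_not (p := fun ω => visits m ω = 1), hneg, card_twoVisit_ipwb_twelve_eq_one hm]

/-- ★★ **Every irreducible positive wall bridge of length `14` has at most two visits** (`N₇₃ = 0`: a class `(7,3)` would add
`≥ y³/β¹⁴ ≈ 10⁻²⁴ > 9·10⁻²⁵` to Kesten's identity at `y = 10⁶`).  (A brute-force census gives `N₇₁ = 15`, `N₇₂ = 3` — not used.)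
[cite: MadrasSlade1993, Section 4.2, (4.2.4) and Theorem 4.2.2 (pp. 91–92)] [cite: Kesten1963SAW, Section 4] -/
theorem visits_le_two_of_mem_ipwb_fourteen {m : ℕ} (hm : m = 14) (hω : ω ∈ ipwb m) : visits m ω ≤ 2 := by
  by_contra hne
  have hv3 : 3 ≤ visits m ω := by omega
  have hK := kesten_six_fx mu_four_lt_Y_fx (s := 7) (by norm_num) (by norm_num) (by norm_num) (by norm_num) (by norm_num)
  obtain ⟨h1, h3, h4, h5, h6⟩ := known_blocks4_fx
  have hs := single_div_le_pwbLaw_fx (y := 1000000) (s := 7) (n := m) (by norm_num) (by omega) hω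
  have hx : (9 / 10 ^ 25 : ℝ) ≤ 1000000 ^ visits m ω / (wallRate 1000000 ^ 2) ^ 7 :=
    calc (9 / 10 ^ 25 : ℝ) ≤ 1000000 ^ 3 / 1000001 ^ 7 := by norm_num
      _ ≤ 1000000 ^ 3 / (wallRate 1000000 ^ 2) ^ 7 := class_term_ge_fx 3 7
      _ ≤ _ := pow_visits_ge_fx hv3 7
  exact no_room4_fx hx (by linarith)

/-- ★★ **Every irreducible positive wall bridge of length `16` has at most three visits** (`N₈₄ = 0`: a class `(8,4)` would add `≥ y⁴/β¹⁶ ≈ 10⁻²⁴`).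
(Census: `N₈₁ = 38`, `N₈₂ = 11`, `N₈₃ = 0` — not used.) [cite: MadrasSlade1993, Section 4.2, (4.2.4) and Theorem 4.2.2 (pp. 91–92)] [cite: Kesten1963SAW, Section 4] -/
theorem visits_le_three_of_mem_ipwb_sixteen {m : ℕ} (hm : m = 16) (hω : ω ∈ ipwb m) : visits m ω ≤ 3 := by
  by_contra hne
  have hv4 : 4 ≤ visits m ω := by omega
  have hK := kesten_six_fx mu_four_lt_Y_fx (s := 8) (by norm_num) (by norm_num) (by norm_num) (by norm_num) (by norm_num)
  obtain ⟨h1, h3, h4, h5, h6⟩ := known_blocks4_fx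
  have hs := single_div_le_pwbLaw_fx (y := 1000000) (s := 8) (n := m) (by norm_num) (by omega) hω
  have hx : (9 / 10 ^ 25 : ℝ) ≤ 1000000 ^ visits m ω / (wallRate 1000000 ^ 2) ^ 8 :=
    calc (9 / 10 ^ 25 : ℝ) ≤ 1000000 ^ 4 / 1000001 ^ 8 := by norm_num
      _ ≤ 1000000 ^ 4 / (wallRate 1000000 ^ 2) ^ 8 := class_term_ge_fx 4 8
      _ ≤ _ := pow_visits_ge_fx hv4 8
  exact no_room4_fx hx (by linarith)

/-- ★★ **Every irreducible positive wall bridge of length `18` has at most four visits** (`N₉₅ = 0`: a class `(9,5)` would add `≥ y⁵/β¹⁸ ≈ 10⁻²⁴`).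
(Census: `N₉₁ = 98`, `N₉₂ = 34`, `N₉₃ = 1`, `N₉₄ = 0` — not used.) [cite: MadrasSlade1993, Section 4.2, (4.2.4) and Theorem 4.2.2 (pp. 91–92)] [cite: Kesten1963SAW, Section 4] -/
theorem visits_le_four_of_mem_ipwb_eighteen {m : ℕ} (hm : m = 18) (hω : ω ∈ ipwb m) : visits m ω ≤ 4 := by
  by_contra hne
  have hv5 : 5 ≤ visits m ω := by omega
  have hK := kesten_six_fx mu_four_lt_Y_fx (s := 9) (by norm_num) (by norm_num) (by norm_num) (by norm_num) (by norm_num)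
  obtain ⟨h1, h3, h4, h5, h6⟩ := known_blocks4_fx
  have hs := single_div_le_pwbLaw_fx (y := 1000000) (s := 9) (n := m) (by norm_num) (by omega) hω
  have hx : (9 / 10 ^ 25 : ℝ) ≤ 1000000 ^ visits m ω / (wallRate 1000000 ^ 2) ^ 9 :=
    calc (9 / 10 ^ 25 : ℝ) ≤ 1000000 ^ 5 / 1000001 ^ 9 := by norm_num
      _ ≤ 1000000 ^ 5 / (wallRate 1000000 ^ 2) ^ 9 := class_term_ge_fx 5 9
      _ ≤ _ := pow_visits_ge_fx hv5 9
  exact no_room4_fx hx (by linarith)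

/-- ★★ **Fourth-order visit deficiency**: every irreducible positive wall bridge of length `n ≥ 14` has at most `n/2 − 5` visits
(`2·visits + 10 ≤ n`): the census for `n = 14, 16, 18`, the entropy bound `4·visits ≤ n + 2` for `n ≥ 20` (lengths are even).  This is
door D3 of the lane («visits ≤ s − 5 for s ≥ 7»), proved analytically; the bound is attained at `n = 14, 16, 18` by two-, three-visit blocks.
[cite: MadrasSlade1993, Section 4.2, (4.2.4) and Theorem 4.2.2 (pp. 91–92), remark before (4.2.21) (p. 94)] [cite: Kesten1963SAW, Section 4] -/
theorem two_mul_visits_add_ten_le (hn : 14 ≤ n) (hω : ω ∈ ipwb n) : 2 * visits n ω + 10 ≤ n := by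
  have hev := even_len_fx hω
  by_cases h14 : n = 14
  · have := visits_le_two_of_mem_ipwb_fourteen h14 hω; omega
  by_cases h16 : n = 16
  · have := visits_le_three_of_mem_ipwb_sixteen h16 hω; omega
  by_cases h18 : n = 18
  · have := visits_le_four_of_mem_ipwb_eighteen h18 hω; omega
  have h20 : 20 ≤ n := by omega
  have h4 := four_mul_visits_le hω
  omega

/-- `visits ≤ n/2 − 5` on `ipwb n`, `n ≥ 14`. [cite: MadrasSlade1993, Section 4.2, (4.2.4) (p. 91)] -/
theorem visits_le_half_sub_five (hn : 14 ≤ n) (hω : ω ∈ ipwb n) : visits n ω ≤ n / 2 - 5 := by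
  have := two_mul_visits_add_ten_le hn hω
  omega

/-! ### §3  The irreducible polynomial `Λ₁₂ = N₆₁·y + y²`, the block law `f₆`, and the envelope `f_s ≤ N_s/y⁵` for `s ≥ 7` -/

open Classical in
/-- ★★ **`Λ₁₂(y) = N₆₁·y + y²`** with `N₆₁ = #` one-visit irreducible blocks of length twelve (symbolic; a census gives `6`).
[cite: MadrasSlade1993, Section 4.2, (4.2.2) (p. 91)] [cite: Kesten1963SAW, Section 4] -/
theorem IPWB_twelve_eq {m : ℕ} (hm : m = 12) (y : ℝ) :
    IPWB m y = #((ipwb m).filter fun ω => visits m ω = 1) * y + y ^ 2 := by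
  rw [IPWB, ← Finset.sum_filter_add_sum_filter_not (ipwb m) (fun ω => visits m ω = 1)]
  have hneg : ((ipwb m).filter fun ω => ¬ visits m ω = 1) = (ipwb m).filter fun ω => visits m ω = 2 := by
    refine Finset.filter_congr fun ω hω => ?_
    have h1 := one_le_visits_fx hω
    have h2 := visits_le_two_of_mem_ipwb_twelve hm hω
    omega
  have hvq : visits m Twelve.qw = 2 := by rw [hm]; exact Twelve.visits_qw
  rw [hneg, twoVisit_ipwb_twelve_eq_singleton hm, Finset.sum_singleton, hvq,
    Finset.sum_congr rfl fun ω hω => by rw [(Finset.mem_filter.1 hω).2, pow_one], Finset.sum_const, nsmul_eq_mul]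

open Classical in
/-- ★★ **`f₆(y) = (N₆₁·y + y²)/β(y)¹²`** (symbolic `N₆₁`). [cite: MadrasSlade1993, Section 4.2, (4.2.2), (4.2.4) (p. 91)] -/
theorem pwbLaw_six_eq {m : ℕ} (hm : m = 12) (y : ℝ) :
    pwbLaw y 6 = (#((ipwb m).filter fun ω => visits m ω = 1) * y + y ^ 2) / wallRate y ^ 12 := by
  have e : pwbLaw y 6 = IPWB m y / wallRate y ^ m := by rw [pwbLaw, hm]
  rw [e, IPWB_twelve_eq hm, hm]

/-- `Λ_n(y) ≤ #(ipwb n)·y^{n/2 − 5}` for `n ≥ 14`, `y ≥ 1`. [cite: MadrasSlade1993, Section 4.2, (4.2.2) (p. 91)] -/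
theorem IPWB_le_card_mul_pow_five (hn : 14 ≤ n) (hy : 1 ≤ y) : IPWB n y ≤ #(ipwb n) * y ^ (n / 2 - 5) := by
  rw [IPWB]
  have h := Finset.sum_le_card_nsmul (ipwb n) (fun ω => y ^ visits n ω) (y ^ (n / 2 - 5)) fun ω hω =>
    pow_le_pow_right₀ hy (visits_le_half_sub_five hn hω)
  rwa [nsmul_eq_mul] at h

/-- ★ `f_s(y) ≤ #(ipwb 2s)/y⁵` for `s ≥ 7`, `y ≥ 1` (`Λ_{2s} ≤ N·y^{s−5}`, `β^{2s} ≥ y^s`; symbolic length `m = 2s`).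
[cite: MadrasSlade1993, Section 4.2, (4.2.2), (4.2.4) (p. 91)] [cite: BeatonBousquetMelouDeGierDuminilCopinGuttmann2014, Section 3.1, Proposition 5] -/
theorem pwbLaw_le_card_div_pow_five {m s : ℕ} (hm : m = 2 * s) (hs : 7 ≤ s) (hy : 1 ≤ y) : pwbLaw y s ≤ #(ipwb m) / y ^ 5 := by
  have hy0 : 0 < y := by linarith
  have e : pwbLaw y s = IPWB m y / wallRate y ^ m := by rw [pwbLaw, hm]
  rw [e]
  have hden : y ^ s ≤ wallRate y ^ m := by rw [hm]; exact pow_le_wallRate_pow_fx hy0 s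
  calc IPWB m y / wallRate y ^ m ≤ #(ipwb m) * y ^ (m / 2 - 5) / wallRate y ^ m :=
        div_le_div_of_nonneg_right (IPWB_le_card_mul_pow_five (by omega) hy) (pow_nonneg (wallRate_pos y).le m)
    _ ≤ #(ipwb m) * y ^ (m / 2 - 5) / y ^ s := div_le_div_of_nonneg_left (by positivity) (by positivity) hden
    _ = #(ipwb m) / y ^ 5 := by
        rw [show m / 2 - 5 = s - 5 by omega, div_eq_div_iff (by positivity) (by positivity)]
        rw [show (#(ipwb m) : ℝ) * y ^ (s - 5) * y ^ 5 = #(ipwb m) * (y ^ (s - 5) * y ^ 5) by ring, ← pow_add,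
          show s - 5 + 5 = s by omega]

/-- ★ `f_s(y) ≤ 9^s/y⁵` for `s ≥ 7`, `y ≥ 1` (`#(ipwb 2s) ≤ 3^{2s}`). [cite: MadrasSlade1993, Section 1.2, (1.2.3); Section 4.2, (4.2.2) (p. 91)] -/
theorem pwbLaw_le_nine_pow_div_pow_five {s : ℕ} (hs : 7 ≤ s) (hy : 1 ≤ y) : pwbLaw y s ≤ 9 ^ s / y ^ 5 := by
  obtain ⟨m, hm⟩ : ∃ m : ℕ, m = 2 * s := ⟨_, rfl⟩
  have h := pwbLaw_le_card_div_pow_five hm hs hy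
  have hc : (#(ipwb m) : ℝ) ≤ 9 ^ s := by
    calc (#(ipwb m) : ℝ) ≤ 3 ^ m := card_ipwb_le_three_pow m
      _ = 9 ^ s := by rw [hm, pow_mul]; norm_num
  exact h.trans (div_le_div_of_nonneg_right hc (by positivity))

/-- ★ **The three order-five head terms are `O(y⁻⁵)`**: `6f₇ + 7f₈ + 8f₉ ≤ 3429388773/y⁵` (`= (6·9⁷ + 7·9⁸ + 8·9⁹)/y⁵`) for `y ≥ 1`.
[cite: MadrasSlade1993, Section 4.2, (4.2.2)–(4.2.5) (p. 91)] -/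
theorem head_six_mul_pwbLaw_le (hy : 1 ≤ y) : 6 * pwbLaw y 7 + 7 * pwbLaw y 8 + 8 * pwbLaw y 9 ≤ 3429388773 / y ^ 5 := by
  have h7 := pwbLaw_le_nine_pow_div_pow_five (s := 7) (by norm_num) hy
  have h8 := pwbLaw_le_nine_pow_div_pow_five (s := 8) (by norm_num) hy
  have h9 := pwbLaw_le_nine_pow_div_pow_five (s := 9) (by norm_num) hy
  have e : (3429388773 : ℝ) / y ^ 5 = 6 * (9 ^ 7 / y ^ 5) + 7 * (9 ^ 8 / y ^ 5) + 8 * (9 ^ 9 / y ^ 5) := by norm_num; ring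
  rw [e]
  linarith

open Classical in
/-- ★ **`5f₆ ≤ 5·y²/β¹² + 2657205/y⁵`** for `y ≥ 1` (`f₆ = (N₆₁ y + y²)/β¹²`, `N₆₁ ≤ #(ipwb 12) ≤ 3¹² = 531441`, `β¹² ≥ y⁶`).
[cite: MadrasSlade1993, Section 1.2, (1.2.3); Section 4.2, (4.2.2)–(4.2.5) (p. 91)] -/
theorem five_mul_pwbLaw_six_le (hy : 1 ≤ y) : 5 * pwbLaw y 6 ≤ 5 * (y ^ 2 / wallRate y ^ 12) + 2657205 / y ^ 5 := by
  have hy0 : 0 < y := by linarith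
  obtain ⟨m, hm⟩ : ∃ m : ℕ, m = 12 := ⟨_, rfl⟩
  rw [pwbLaw_six_eq hm, add_div]
  have hN : (#((ipwb m).filter fun ω => visits m ω = 1) : ℝ) ≤ 531441 := by
    calc (#((ipwb m).filter fun ω => visits m ω = 1) : ℝ) ≤ #(ipwb m) := by
          exact_mod_cast Finset.card_le_card (Finset.filter_subset _ _)
      _ ≤ 3 ^ m := card_ipwb_le_three_pow m
      _ = 531441 := by rw [hm]; norm_num
  have hden : y ^ 6 ≤ wallRate y ^ 12 := pow_le_wallRate_pow_fx hy0 6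
  have h1 : (#((ipwb m).filter fun ω => visits m ω = 1) : ℝ) * y / wallRate y ^ 12 ≤ 531441 * y / y ^ 6 :=
    calc (#((ipwb m).filter fun ω => visits m ω = 1) : ℝ) * y / wallRate y ^ 12 ≤ 531441 * y / wallRate y ^ 12 :=
          div_le_div_of_nonneg_right (mul_le_mul_of_nonneg_right hN hy0.le) (pow_nonneg (wallRate_pos y).le 12)
      _ ≤ 531441 * y / y ^ 6 := div_le_div_of_nonneg_left (by positivity) (by positivity) hden
  have e : (531441 : ℝ) * y / y ^ 6 = 531441 / y ^ 5 := by
    rw [div_eq_div_iff (by positivity) (by positivity)]; ring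
  rw [e] at h1
  have e5 : (2657205 : ℝ) / y ^ 5 = 5 * (531441 / y ^ 5) := by ring
  rw [e5, mul_add]
  have h5 := mul_le_mul_of_nonneg_left h1 (show (0 : ℝ) ≤ 5 by norm_num)
  linarith

/-! ### §4  The excess beyond half-length nine, its envelope bound, and the fourth-order window for the renewal mean -/

/-- **Excess decomposition at order four**: for `y > μ⁴`,
`Σ_{j ≥ 0} (j + 9) f_{j+10}(y) = m(y) − 1 − (2f₃ + 3f₄ + 4f₅ + 5f₆ + 6f₇ + 7f₈ + 8f₉)`.
[cite: MadrasSlade1993, Section 4.2, (4.2.4)–(4.2.5) and Theorem 4.2.2 (pp. 91–92)] [cite: Feller1968, XIII.3] -/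
theorem hasSum_excess_tail_ten (hy : hexConnectiveConstant ^ 4 < y) :
    HasSum (fun j : ℕ => ((j : ℝ) + 9) * pwbLaw y (j + 10))
      (pwbMean y - 1 - (2 * pwbLaw y 3 + 3 * pwbLaw y 4 + 4 * pwbLaw y 5 + 5 * pwbLaw y 6 + 6 * pwbLaw y 7 + 7 * pwbLaw y 8 +
        8 * pwbLaw y 9)) := by
  have ht := (hasSum_nat_add_iff' 2).2 (hasSum_excess_tail_eight hy)
  have hsum : ∑ i ∈ Finset.range 2, ((i : ℝ) + 7) * pwbLaw y (i + 8) = 7 * pwbLaw y 8 + 8 * pwbLaw y 9 := by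
    simp only [Finset.sum_range_succ, Finset.sum_range_zero]
    push_cast
    ring
  rw [hsum] at ht
  have e : pwbMean y - 1 - (2 * pwbLaw y 3 + 3 * pwbLaw y 4 + 4 * pwbLaw y 5 + 5 * pwbLaw y 6 + 6 * pwbLaw y 7 + 7 * pwbLaw y 8 +
        8 * pwbLaw y 9) =
      pwbMean y - 1 - (2 * pwbLaw y 3 + 3 * pwbLaw y 4 + 4 * pwbLaw y 5 + 5 * pwbLaw y 6 + 6 * pwbLaw y 7) -
        (7 * pwbLaw y 8 + 8 * pwbLaw y 9) := by ring
  rw [e]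
  refine ht.congr_fun fun j => ?_
  rw [show j + 2 + 8 = j + 10 by omega]
  push_cast
  ring

/-- `θ = μ²/√y ≤ ½` once `y ≥ 48` (`4μ⁴ < 48`). [cite: MadrasSlade1993, Section 4.2, remark before (4.2.21) (p. 94)] [cite: DuminilCopinSmirnov2012, Theorem 1] -/
private theorem theta_le_half_fx (hy : 48 ≤ y) : hexConnectiveConstant ^ 2 / Real.sqrt y ≤ 1 / 2 := by
  have hy0 : 0 < y := by linarith
  have hs0 : 0 < Real.sqrt y := Real.sqrt_pos.2 hy0
  have hy2 : Real.sqrt y ^ 2 = y := Real.sq_sqrt hy0.le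
  have h4 : (2 * hexConnectiveConstant ^ 2) ^ 2 ≤ Real.sqrt y ^ 2 := by
    rw [hy2]
    have e : (2 * hexConnectiveConstant ^ 2) ^ 2 = 4 * hexConnectiveConstant ^ 4 := by ring
    rw [e]
    have := mu_four_lt_twelve_fx
    linarith
  have h2 : 2 * hexConnectiveConstant ^ 2 ≤ Real.sqrt y :=
    (pow_le_pow_iff_left₀ (by positivity) hs0.le two_ne_zero).1 h4
  rw [div_le_iff₀ hs0]
  linarith

/-- ★ **Tail bound at order four**: for `y ≥ 48`, `m(y) − 1 − (2f₃ + 3f₄ + 4f₅ + 5f₆ + 6f₇ + 7f₈ + 8f₉) ≤ 20 μ²²/(y⁴√y)`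
(envelope `f_s ≤ μ²√y θ^s`, `θ = μ²/√y ≤ ½`, `Σ_j (j + 9)θ^j = θ/(1 − θ)² + 9/(1 − θ) ≤ 20`, prefactor `μ²√y θ¹⁰ = μ²²/(y⁴√y)`).
[cite: MadrasSlade1993, Section 4.2, Theorem 4.2.2 and remark before (4.2.21) (pp. 91–94)] [cite: Feller1968, XIII.3] -/
theorem excess_tail_ten_le (hy : 48 ≤ y) :
    pwbMean y - 1 - (2 * pwbLaw y 3 + 3 * pwbLaw y 4 + 4 * pwbLaw y 5 + 5 * pwbLaw y 6 + 6 * pwbLaw y 7 + 7 * pwbLaw y 8 +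
        8 * pwbLaw y 9) ≤ 20 * hexConnectiveConstant ^ 22 / (y ^ 4 * Real.sqrt y) := by
  have hy0 : 0 < y := by linarith
  have hy1 : 1 ≤ y := by linarith
  have hμ : hexConnectiveConstant ^ 4 < y := mu_four_lt_twelve_fx.trans_le (by linarith)
  have hθhalf := theta_le_half_fx hy
  have hs0 : 0 < Real.sqrt y := Real.sqrt_pos.2 hy0
  have hμ2 : 0 < hexConnectiveConstant ^ 2 := pow_pos hexConnectiveConstant_pos 2
  have hθ0 : 0 < hexConnectiveConstant ^ 2 / Real.sqrt y := div_pos hμ2 hs0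
  have hθ1 : hexConnectiveConstant ^ 2 / Real.sqrt y < 1 := by linarith
  have ht := hasSum_excess_tail_ten hμ
  have hG1 : HasSum (fun j : ℕ => (j : ℝ) * (hexConnectiveConstant ^ 2 / Real.sqrt y) ^ j)
      ((hexConnectiveConstant ^ 2 / Real.sqrt y) / (1 - hexConnectiveConstant ^ 2 / Real.sqrt y) ^ 2) :=
    hasSum_coe_mul_geometric_of_norm_lt_one (by rw [Real.norm_of_nonneg hθ0.le]; exact hθ1)
  have hG0 : HasSum (fun j : ℕ => (hexConnectiveConstant ^ 2 / Real.sqrt y) ^ j)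
      (1 - hexConnectiveConstant ^ 2 / Real.sqrt y)⁻¹ := hasSum_geometric_of_lt_one hθ0.le hθ1
  have hG : HasSum (fun j : ℕ => ((j : ℝ) + 9) *
      (hexConnectiveConstant ^ 2 * Real.sqrt y * (hexConnectiveConstant ^ 2 / Real.sqrt y) ^ (j + 10)))
      (hexConnectiveConstant ^ 2 * Real.sqrt y * (hexConnectiveConstant ^ 2 / Real.sqrt y) ^ 10 *
        ((hexConnectiveConstant ^ 2 / Real.sqrt y) / (1 - hexConnectiveConstant ^ 2 / Real.sqrt y) ^ 2 +
          9 * (1 - hexConnectiveConstant ^ 2 / Real.sqrt y)⁻¹)) := by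
    have h := (hG1.add (hG0.mul_left 9)).mul_left
      (hexConnectiveConstant ^ 2 * Real.sqrt y * (hexConnectiveConstant ^ 2 / Real.sqrt y) ^ 10)
    exact h.congr_fun fun j => by ring
  have hle := hasSum_le (fun j => mul_le_mul_of_nonneg_left (pwbLaw_le_geom hy1 (j + 10)) (by positivity)) ht hG
  -- the numerical factor `θ/(1 − θ)² + 9/(1 − θ) ≤ 2 + 18 = 20` for `θ ≤ ½`
  set θ := hexConnectiveConstant ^ 2 / Real.sqrt y with hθ_def
  have h1θ : 1 / 2 ≤ 1 - θ := by linarith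
  have hinv : (1 - θ)⁻¹ ≤ 2 := by
    rw [inv_le_comm₀ (by linarith) (by norm_num)]
    linarith
  have hq : 1 / 4 ≤ (1 - θ) ^ 2 := by nlinarith
  have hdiv : θ / (1 - θ) ^ 2 ≤ 2 := by
    rw [div_le_iff₀ (by positivity)]
    linarith
  have hsum : θ / (1 - θ) ^ 2 + 9 * (1 - θ)⁻¹ ≤ 20 := by linarith
  -- the prefactor `μ²√y θ¹⁰ = μ²²/(y⁴√y)`
  set s := Real.sqrt y with hs_def
  have hys : y = s ^ 2 := (Real.sq_sqrt hy0.le).symm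
  have hE0 : 0 ≤ hexConnectiveConstant ^ 2 * s * θ ^ 10 := by positivity
  have hEθ : hexConnectiveConstant ^ 2 * s * θ ^ 10 = hexConnectiveConstant ^ 22 / (y ^ 4 * s) := by
    rw [show y ^ 4 * s = s ^ 9 by rw [hys]; ring, hθ_def, div_pow, ← mul_div_assoc,
      div_eq_div_iff (pow_ne_zero 10 hs0.ne') (pow_ne_zero 9 hs0.ne')]
    ring
  calc pwbMean y - 1 - (2 * pwbLaw y 3 + 3 * pwbLaw y 4 + 4 * pwbLaw y 5 + 5 * pwbLaw y 6 + 6 * pwbLaw y 7 + 7 * pwbLaw y 8 +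
        8 * pwbLaw y 9)
      ≤ hexConnectiveConstant ^ 2 * s * θ ^ 10 * (θ / (1 - θ) ^ 2 + 9 * (1 - θ)⁻¹) := hle
    _ ≤ hexConnectiveConstant ^ 2 * s * θ ^ 10 * 20 := mul_le_mul_of_nonneg_left hsum hE0
    _ = 20 * hexConnectiveConstant ^ 22 / (y ^ 4 * s) := by rw [hEθ]; ring

/-- ★★ **Upper bound at order four** (`y ≥ 48`): `y⁴ (m(y) − 1 − 2y/β⁶ − 3y/β⁸) ≤ 12·(y⁵/β¹⁰) + 5·(y⁶/β¹²) + 3432045978/y + 20 μ²²/√y`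
— exact `f₃, f₄, f₅`, `5f₆ ≤ 5y²/β¹² + 2657205/y⁵`, the census bound `6f₇ + 7f₈ + 8f₉ ≤ 3429388773/y⁵`, the tail.
[cite: MadrasSlade1993, Section 4.2, (4.2.2)–(4.2.5) and Theorem 4.2.2 (pp. 91–92)] [cite: Kesten1963SAW, Section 4] -/
theorem pow_four_mul_pwbMean_sub_le (hy : 48 ≤ y) :
    y ^ 4 * (pwbMean y - 1 - 2 * y / wallRate y ^ 6 - 3 * y / wallRate y ^ 8) ≤
      12 * (y ^ 5 / wallRate y ^ 10) + 5 * (y ^ 6 / wallRate y ^ 12) + 3432045978 / y + 20 * hexConnectiveConstant ^ 22 / Real.sqrt y := by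
  have hy0 : 0 < y := by linarith
  have hy1 : 1 ≤ y := by linarith
  have hs0 : 0 < Real.sqrt y := Real.sqrt_pos.2 hy0
  have ht := excess_tail_ten_le hy
  have hh := head_six_mul_pwbLaw_le hy1
  have h6 := five_mul_pwbLaw_six_le hy1
  rw [pwbLaw_three, pwbLaw_four_eq, pwbLaw_five_eq] at ht
  have hle : pwbMean y - 1 - 2 * y / wallRate y ^ 6 - 3 * y / wallRate y ^ 8 ≤
      12 * (y / wallRate y ^ 10) + 5 * (y ^ 2 / wallRate y ^ 12) + 3432045978 / y ^ 5 +
        20 * hexConnectiveConstant ^ 22 / (y ^ 4 * Real.sqrt y) := by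
    have e2 : 2 * y / wallRate y ^ 6 = 2 * (y / wallRate y ^ 6) := by ring
    have e3 : 3 * y / wallRate y ^ 8 = 3 * (y / wallRate y ^ 8) := by ring
    have e4 : 4 * (3 * y / wallRate y ^ 10) = 12 * (y / wallRate y ^ 10) := by ring
    have e5 : (3432045978 : ℝ) / y ^ 5 = 2657205 / y ^ 5 + 3429388773 / y ^ 5 := by rw [← add_div]; norm_num
    rw [e2, e3, e5]
    linarith
  have hm := mul_le_mul_of_nonneg_left hle (pow_pos hy0 4).le
  have e1 : y ^ 4 * (12 * (y / wallRate y ^ 10)) = 12 * (y ^ 5 / wallRate y ^ 10) := by ring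
  have e1' : y ^ 4 * (5 * (y ^ 2 / wallRate y ^ 12)) = 5 * (y ^ 6 / wallRate y ^ 12) := by ring
  have e2 : y ^ 4 * (3432045978 / y ^ 5) = 3432045978 / y := by
    rw [mul_div_assoc', div_eq_div_iff (by positivity) (by positivity)]; ring
  have e3 : y ^ 4 * (20 * hexConnectiveConstant ^ 22 / (y ^ 4 * Real.sqrt y)) = 20 * hexConnectiveConstant ^ 22 / Real.sqrt y := by
    rw [mul_div_assoc', div_eq_div_iff (by positivity) (by positivity)]; ring
  calc y ^ 4 * (pwbMean y - 1 - 2 * y / wallRate y ^ 6 - 3 * y / wallRate y ^ 8)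
      ≤ y ^ 4 * (12 * (y / wallRate y ^ 10) + 5 * (y ^ 2 / wallRate y ^ 12) + 3432045978 / y ^ 5 +
          20 * hexConnectiveConstant ^ 22 / (y ^ 4 * Real.sqrt y)) := hm
    _ = 12 * (y ^ 5 / wallRate y ^ 10) + 5 * (y ^ 6 / wallRate y ^ 12) + 3432045978 / y + 20 * hexConnectiveConstant ^ 22 / Real.sqrt y := by
        rw [mul_add, mul_add, mul_add, e1, e1', e2, e3]

/-- ★ The order-four window (`y ≥ 48`): `12·(y⁵/β¹⁰) + 5·(y⁶/β¹²) ≤ y⁴ (m(y) − 1 − 2y/β⁶ − 3y/β⁸) ≤ 12·(y⁵/β¹⁰) + 5·(y⁶/β¹²) + 3432045978/y + 20 μ²²/√y`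
(the floor is «FLOOR-SEVENTEEN»'s). [cite: MadrasSlade1993, Section 4.2, (4.2.5) and Theorem 4.2.2 (pp. 91–92)] -/
theorem pow_four_mul_pwbMean_sub_mem_Icc (hy : 48 ≤ y) :
    y ^ 4 * (pwbMean y - 1 - 2 * y / wallRate y ^ 6 - 3 * y / wallRate y ^ 8) ∈
      Set.Icc (12 * (y ^ 5 / wallRate y ^ 10) + 5 * (y ^ 6 / wallRate y ^ 12))
        (12 * (y ^ 5 / wallRate y ^ 10) + 5 * (y ^ 6 / wallRate y ^ 12) + 3432045978 / y + 20 * hexConnectiveConstant ^ 22 / Real.sqrt y) :=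
  ⟨floor_seventeen_pow_four_mul (mu_four_lt_twelve_fx.trans_le (by linarith)), pow_four_mul_pwbMean_sub_le hy⟩

/-! ### §5  THE FOURTH-ORDER LIMIT `y⁴ (m(y) − 1 − 2y/β⁶ − 3y/β⁸) → 17` and `m(y) = 1 + 2/y² + 3/y³ + 11/y⁴ + o(y⁻⁴)` -/

/-- ★★★ **`y⁴ (m(y) − 1 − 2y/β(y)⁶ − 3y/β(y)⁸) → 17`** (`y → ∞`), `17 = 4·N₅₁ + 5·N₆₂ = 4·3 + 5·1`: the three tens and the hooked twelve carry
the WHOLE fourth order of the renewal mean beyond the dip and the flat excursion — the remaining blocks of half-length `6, 7, 8, 9` are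
`O(y⁻⁵)` by the order-four census and the rest is `O(y^{-9/2})` by the envelope.  This is the limit `L` of «TEN-THREE»'s
`twelve_le_of_tendsto_pow_four_mul` and «FLOOR-SEVENTEEN»'s `seventeen_le_of_tendsto_pow_four_mul`, now shown to EXIST and to equal `17`.
[cite: MadrasSlade1993, Section 4.2, (4.2.5) and Theorem 4.2.2 (pp. 91–92)] [cite: Kesten1963SAW, Section 4] [cite: JansevanRensburg2000, Section 3.3.2, Lemma 3.20] -/
theorem tendsto_pow_four_mul_pwbMean_sub :
    Tendsto (fun y : ℝ => y ^ 4 * (pwbMean y - 1 - 2 * y / wallRate y ^ 6 - 3 * y / wallRate y ^ 8)) atTop (𝓝 17) := by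
  have h0 : Tendsto (fun y : ℝ => 12 * (y ^ 5 / wallRate y ^ 10) + 5 * (y ^ 6 / wallRate y ^ 12)) atTop (𝓝 17) := by
    have h := (tendsto_pow_five_div_wallRate_pow_ten.const_mul 12).add (tendsto_pow_six_div_wallRate_pow_twelve.const_mul 5)
    norm_num at h
    exact h
  have h1 : Tendsto (fun y : ℝ => (3432045978 : ℝ) / y) atTop (𝓝 0) := tendsto_const_nhds.div_atTop tendsto_id
  have h2 : Tendsto (fun y : ℝ => 20 * hexConnectiveConstant ^ 22 / Real.sqrt y) atTop (𝓝 0) :=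
    tendsto_const_nhds.div_atTop Real.tendsto_sqrt_atTop
  have hup : Tendsto (fun y : ℝ => 12 * (y ^ 5 / wallRate y ^ 10) + 5 * (y ^ 6 / wallRate y ^ 12) + 3432045978 / y +
      20 * hexConnectiveConstant ^ 22 / Real.sqrt y) atTop (𝓝 17) := by
    simpa using (h0.add h1).add h2
  refine tendsto_of_tendsto_of_tendsto_of_le_of_le' h0 hup ?_ ?_
  · filter_upwards [eventually_gt_atTop (hexConnectiveConstant ^ 4)] with y hy
    exact floor_seventeen_pow_four_mul hy
  · filter_upwards [eventually_ge_atTop (48 : ℝ)] with y hy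
    exact pow_four_mul_pwbMean_sub_le hy

/-- ★ For every `a > 17`, eventually `y⁴ (m(y) − 1 − 2y/β⁶ − 3y/β⁸) ≤ a` (the matching upper companion of «FLOOR-SEVENTEEN»'s
`eventually_seventeen_sub_le_pow_four_mul_pwbMean`). [cite: MadrasSlade1993, Section 4.2, (4.2.5) (p. 91)] -/
theorem eventually_pow_four_mul_pwbMean_le {a : ℝ} (ha : 17 < a) :
    ∀ᶠ y : ℝ in atTop, y ^ 4 * (pwbMean y - 1 - 2 * y / wallRate y ^ 6 - 3 * y / wallRate y ^ 8) ≤ a :=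
  tendsto_pow_four_mul_pwbMean_sub.eventually (eventually_le_nhds ha)

/-- `y/β(y)² → 1` (`β ∼ √y`). [cite: BeatonBousquetMelouDeGierDuminilCopinGuttmann2014, Section 3.1, Proposition 5 (arXiv v5 p. 9)] -/
theorem tendsto_div_wallRate_sq : Tendsto (fun y : ℝ => y / wallRate y ^ 2) atTop (𝓝 1) := by
  have h1 : Tendsto (fun y : ℝ => ((wallRate y / Real.sqrt y) ^ 2)⁻¹) atTop (𝓝 ((1 : ℝ) ^ 2)⁻¹) :=
    (tendsto_wallRate_div_sqrt.pow 2).inv₀ (by norm_num)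
  rw [one_pow, inv_one] at h1
  refine h1.congr' ?_
  filter_upwards [eventually_gt_atTop (0 : ℝ)] with y hy
  rw [div_pow, Real.sq_sqrt hy.le, inv_div]

/-- ★ **`y² (1 − y/β(y)²) → 1`** — the second-order sharpness `y (β² − y) → 1` («SECOND-ORDER-SHARP») in ratio form.
[cite: BeatonBousquetMelouDeGierDuminilCopinGuttmann2014, Section 3.1, Proposition 5 (arXiv v5 p. 9) and p. 10] -/
theorem tendsto_sq_mul_one_sub_div_wallRate_sq : Tendsto (fun y : ℝ => y ^ 2 * (1 - y / wallRate y ^ 2)) atTop (𝓝 1) := by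
  have h := tendsto_mul_wallRate_sq_sub.mul tendsto_div_wallRate_sq
  rw [one_mul] at h
  refine h.congr' ?_
  filter_upwards [eventually_gt_atTop (0 : ℝ)] with y hy
  have hw : wallRate y ≠ 0 := (wallRate_pos y).ne'
  field_simp

/-- **The dip term to fourth order**: `y⁴·(2y/β(y)⁶) − 2y² → −6`, i.e. `2y/β⁶ = 2/y² − 6/y⁴ + o(y⁻⁴)` (with `r = y/β²`:
`y⁴·2y/β⁶ − 2y² = −2·y²(1 − r)·(1 + r + r²)`, `y²(1 − r) → 1`, `r → 1`). [cite: BeatonBousquetMelouDeGierDuminilCopinGuttmann2014, Section 3.1, Proposition 5 (arXiv v5 p. 9)]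
[cite: MadrasSlade1993, Section 4.2, (4.2.2) (p. 91)] -/
theorem tendsto_pow_four_mul_two_mul_div_sub :
    Tendsto (fun y : ℝ => y ^ 4 * (2 * y / wallRate y ^ 6) - 2 * y ^ 2) atTop (𝓝 (-6)) := by
  have h := (tendsto_sq_mul_one_sub_div_wallRate_sq.mul
    ((tendsto_const_nhds (x := (1 : ℝ))).add (tendsto_div_wallRate_sq.add (tendsto_div_wallRate_sq.pow 2)))).const_mul (-2)
  have e : (-2 : ℝ) * (1 * (1 + (1 + 1 ^ 2))) = -6 := by norm_num
  rw [e] at h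
  refine h.congr' ?_
  filter_upwards [eventually_gt_atTop (0 : ℝ)] with y hy
  have hw : wallRate y ≠ 0 := (wallRate_pos y).ne'
  field_simp
  ring

/-- **The flat-excursion term to fourth order**: `y⁴·(3y/β(y)⁸) − 3y → 0`, i.e. `3y/β⁸ = 3/y³ + o(y⁻⁴)`
(`y⁴·3y/β⁸ − 3y = −3·y²(1 − r)·(1 + r + r² + r³)/y`). [cite: BeatonBousquetMelouDeGierDuminilCopinGuttmann2014, Section 3.1, Proposition 5 (arXiv v5 p. 9)]
[cite: MadrasSlade1993, Section 4.2, (4.2.2) (p. 91)] -/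
theorem tendsto_pow_four_mul_three_mul_div_sub :
    Tendsto (fun y : ℝ => y ^ 4 * (3 * y / wallRate y ^ 8) - 3 * y) atTop (𝓝 0) := by
  have hb : Tendsto (fun y : ℝ => 1 + (y / wallRate y ^ 2 + ((y / wallRate y ^ 2) ^ 2 + (y / wallRate y ^ 2) ^ 3))) atTop
      (𝓝 (1 + (1 + (1 ^ 2 + 1 ^ 3)))) :=
    tendsto_const_nhds.add (tendsto_div_wallRate_sq.add ((tendsto_div_wallRate_sq.pow 2).add (tendsto_div_wallRate_sq.pow 3)))
  have h := ((tendsto_sq_mul_one_sub_div_wallRate_sq.mul hb).mul tendsto_inv_atTop_zero).const_mul (-3)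
  rw [mul_zero, mul_zero] at h
  refine h.congr' ?_
  filter_upwards [eventually_gt_atTop (0 : ℝ)] with y hy
  have hw : wallRate y ≠ 0 := (wallRate_pos y).ne'
  have hy' : y ≠ 0 := hy.ne'
  field_simp
  ring

/-- ★★★ **`y⁴ (m(y) − 1 − 2/y² − 3/y³) → 11`**, i.e. **`m(y) = 1 + 2/y² + 3/y³ + 11/y⁴ + o(y⁻⁴)`** (`y → ∞`): the renewal mean of the
positive-wall-bridge renewal structure to fourth order, `11 = 17 − 6` (the dip's own fourth-order correction `2y/β⁶ = 2/y² − 6/y⁴ + …`).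
[cite: MadrasSlade1993, Section 4.2, (4.2.5) and Theorem 4.2.2 (pp. 91–92)] [cite: Kesten1963SAW, Section 4] [cite: EntingJensen2009, Section 7.4.2, Fig. 7.10] -/
theorem tendsto_pow_four_mul_pwbMean_sub_one_sub_sub :
    Tendsto (fun y : ℝ => y ^ 4 * (pwbMean y - 1 - 2 / y ^ 2 - 3 / y ^ 3)) atTop (𝓝 11) := by
  have h := (tendsto_pow_four_mul_pwbMean_sub.add tendsto_pow_four_mul_two_mul_div_sub).add tendsto_pow_four_mul_three_mul_div_sub
  have e : (17 : ℝ) + -6 + 0 = 11 := by norm_num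
  rw [e] at h
  refine h.congr' ?_
  filter_upwards [eventually_gt_atTop (0 : ℝ)] with y hy
  have hy' : y ≠ 0 := hy.ne'
  have e2 : y ^ 4 * (2 / y ^ 2) = 2 * y ^ 2 := by
    rw [mul_div_assoc', div_eq_iff (by positivity)]; ring
  have e3 : y ^ 4 * (3 / y ^ 3) = 3 * y := by
    rw [mul_div_assoc', div_eq_iff (by positivity)]; ring
  calc y ^ 4 * (pwbMean y - 1 - 2 * y / wallRate y ^ 6 - 3 * y / wallRate y ^ 8) + (y ^ 4 * (2 * y / wallRate y ^ 6) - 2 * y ^ 2) +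
        (y ^ 4 * (3 * y / wallRate y ^ 8) - 3 * y)
      = y ^ 4 * (pwbMean y - 1) - 2 * y ^ 2 - 3 * y := by ring
    _ = y ^ 4 * (pwbMean y - 1 - 2 / y ^ 2 - 3 / y ^ 3) := by
        rw [show y ^ 4 * (pwbMean y - 1 - 2 / y ^ 2 - 3 / y ^ 3) =
          y ^ 4 * (pwbMean y - 1) - y ^ 4 * (2 / y ^ 2) - y ^ 4 * (3 / y ^ 3) by ring, e2, e3]

/-- ★ **Asymptotic equivalence** `m(y) − 1 − 2/y² − 3/y³ ∼ 11/y⁴` (`y → ∞`). [cite: MadrasSlade1993, Section 4.2, Theorem 4.2.2 (pp. 91–92)] [cite: Kesten1963SAW, Section 4] -/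
theorem isEquivalent_pwbMean_sub_three_terms :
    (fun y : ℝ => pwbMean y - 1 - 2 / y ^ 2 - 3 / y ^ 3) ~[atTop] fun y : ℝ => 11 / y ^ 4 := by
  have hz : ∀ᶠ y : ℝ in atTop, (11 : ℝ) / y ^ 4 ≠ 0 := by
    filter_upwards [eventually_gt_atTop (0 : ℝ)] with y hy
    positivity
  refine (isEquivalent_iff_tendsto_one hz).2 ?_
  have h := tendsto_pow_four_mul_pwbMean_sub_one_sub_sub.div_const 11
  rw [show ((11 : ℝ) / 11) = 1 by norm_num] at h
  refine h.congr' ?_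
  filter_upwards [eventually_gt_atTop (0 : ℝ)] with y hy
  simp only [Pi.div_apply]
  rw [div_div_eq_mul_div]
  ring

end Literature.Probability.RandomPlanarGeometry.SAW.HexBW.Wall
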